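import Literature.Probability.RandomPlanarGeometry.LoewnerAliveMargin
import Literature.Probability.RandomPlanarGeometry.LoewnerImageFlowContinuity
import Literature.Probability.RandomPlanarGeometry.StarShiftSubordination
import Literature.Probability.RandomPlanarGeometry.SLEImageDriverEnvelope
import Literature.Probability.RandomPlanarGeometry.StarHullClopenPiece
import Literature.Probability.RandomPlanarGeometry.LoewnerBoundaryExtension
import Literature.Probability.RandomPlanarGeometry.LoewnerMapProofs
import Literature.Probability.RandomPlanarGeometry.LoewnerHullHitting
import HarnessLib

/-!
# The shift `L_{B_t}` is continuous across the first contact of the closed hulls with a `*`-hull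

Topic `Probability/RandomPlanarGeometry`; theorems only (crux `stmt-CriticalPhenomena-0698`, stub
`stub_isLocal`, through-swallow image chain of the locality of SLE₆: G. F. Lawler (2005), §6.3,
continuity of `U*_t` through the swallow instants; Lawler–Schramm–Werner (2003), §5). For a driving
function `W` and a `*`-hull `B` first touched by the closed hulls at the finite time `T = T_B`,
suppose the part `B' = B ∖ K̂_T` still alive at `T` is closed (a clopen piece, hence a `*`-hull or
`∅`). Then the constant `L_{slidHull W B t} = starShift (g_t(B) − W_t)` tends, as `t ↑ T`, to
`L_{slidHull W B' T}`:

* `starShift_empty` — `L_∅ = 0` (the canonical map of the empty hull is the identity);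
* `swallowingTime_eq_of_mem_inter_closedHull` — every point of the contacted part `B ∩ K̂_T` is
  swallowed exactly at `T`;
* `norm_map_sub_driving_le_of_swallowed_at` — hence `‖g_t z − W_t‖ ≤ osc_{[t,T]} W + 4√(T − t)`
  for such `z ∈ ℍ` (Lawler's Lemma 4.13 for the chain restarted at `t`, through the flow cocycle);
* **`tendsto_starShift_slidHull_hullHitTime`** — the statement: shift additivity
  `L_{B_t} = L_{B'_t} + L_{Q_t}` (`starShift_eq_add_starShift_quotientHull`), the quotient hull
  `Q_t = cl Φ_{B'_t}((B_t ∖ B'_t) ∩ ℍ)` lies in `B̄(0, 2 r_t)` (`E_{B'_t}` is `2`-Lipschitz near `0`,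
  uniformly for `t` near `T` since `dist(0, B'_t) → dist(0, B'_T) > 0`), `‖L_{Q_t}‖ ≤ 1160 r_t`
  (`norm_starShift_le`), and `t ↦ L_{B'_t}` is continuous at the alive time `T`
  (`continuousWithinAt_imageDriver`).
-/

noncomputable section

open Set Filter Topology Function Complex Metric
open UpperHalfPlane (upperHalfPlaneSet isOpen_upperHalfPlaneSet)
open scoped NNReal

namespace Literature.Probability.RandomPlanarGeometry

/-! ### The shift of the empty hull -/

/-- **`L_∅ = 0`**: the canonical restriction map of the empty hull is the identity
(`IsRestrictionMap.unique` with `restrictionMapEmpty`), so `E_∅(z) − z = 0` off the real axis and the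
limit `L_∅` at infinity vanishes. [folklore] -/
theorem starShift_empty : starShift (∅ : Set ℂ) = 0 := by
  have hE : IsStarHull (∅ : Set ℂ) := isStarHull_empty
  have hΦ := isRestrictionMap_starRMap hE
  rw [starShift_eq hE]
  have hlim := tendsto_hullExt_sub_self hE.1 hΦ
  -- `E_∅ z - z = 0` off the real axis
  have heq : EqOn (starRMap ∅ hE) restrictionMapEmpty (upperHalfPlaneSet \ ∅) :=
    IsRestrictionMap.unique hE isRestrictionMap_empty hΦ
  have hzero : ∀ z : ℂ, z.im ≠ 0 → hullExt (starRMap ∅ hE) z - z = 0 := by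
    intro z hz
    rcases lt_or_gt_of_ne hz with hneg | hpos
    · rw [hullExt_of_im_neg hneg]
      have hc : (starRingEnd ℂ) z ∈ upperHalfPlaneSet \ ∅ :=
        ⟨show 0 < ((starRingEnd ℂ) z).im by rw [Complex.conj_im]; linarith, Set.notMem_empty _⟩
      rw [heq hc, restrictionMapEmpty_apply, Complex.conj_conj, sub_self]
    · rw [hullExt_of_mem_diff ⟨hpos, Set.notMem_empty z⟩, heq ⟨hpos, Set.notMem_empty z⟩,
        restrictionMapEmpty_apply, sub_self]
  -- the restricted filter is nontrivial and the function vanishes there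
  have hne : (cocompact ℂ ⊓ 𝓟 {z : ℂ | z.im ≠ 0}).NeBot := by
    refine Filter.inf_neBot_iff.2 fun {U} hU {V} hV ↦ ?_
    obtain ⟨K, hK, hKU⟩ := mem_cocompact.1 hU
    obtain ⟨R, hR⟩ := hK.isBounded.subset_closedBall 0
    refine ⟨((|R| + 1 : ℝ) : ℂ) * Complex.I, hKU ?_, hV ?_⟩
    · intro hmem
      have := hR hmem
      rw [mem_closedBall, dist_zero_right, Complex.norm_mul, Complex.norm_I, mul_one,
        Complex.norm_real, Real.norm_eq_abs, abs_of_pos (by positivity)] at this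
      linarith [le_abs_self R]
    · show (((|R| + 1 : ℝ) : ℂ) * Complex.I).im ≠ 0
      rw [Complex.mul_im, Complex.ofReal_re, Complex.ofReal_im, Complex.I_re, Complex.I_im]
      simp only [mul_zero, mul_one, add_zero]
      positivity
  haveI := hne
  have h1 : Tendsto (fun z ↦ hullExt (starRMap ∅ hE) z - z) (cocompact ℂ ⊓ 𝓟 {z : ℂ | z.im ≠ 0})
      (𝓝 (hullShift (starRMap ∅ hE))) := hlim.mono_left inf_le_left
  have h2 : Tendsto (fun z ↦ hullExt (starRMap ∅ hE) z - z) (cocompact ℂ ⊓ 𝓟 {z : ℂ | z.im ≠ 0})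
      (𝓝 0) := by
    refine (tendsto_const_nhds (x := (0 : ℂ))).congr' ?_
    exact eventually_inf_principal.2 (Eventually.of_forall fun z hz ↦ (hzero z hz).symm)
  exact tendsto_nhds_unique h1 h2

namespace Loewner

variable {W : ℝ≥0 → ℝ}

/-! ### Points of the contacted part are swallowed exactly at the contact time -/

/-- A point of `B ∩ K̂_T` (with `B` alive before `T = T_B`) is swallowed exactly at `T`. [folklore] -/
theorem swallowingTime_eq_of_mem_inter_closedHull {B : Set ℂ} {T : ℝ≥0} (hT : hullHitTime W B = T)
    {z : ℂ} (hzB : z ∈ B) (hzK : z ∈ closedHull W T) : swallowingTime W z = T := by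
  refine le_antisymm hzK.2 ?_
  by_contra hlt
  push Not at hlt
  obtain ⟨u, hu⟩ := WithTop.ne_top_iff_exists.1 (ne_top_of_lt hlt)
  rw [← hu] at hlt
  have huT : u < T := WithTop.coe_lt_coe.1 hlt
  have halive : Disjoint (closedHull W u) B :=
    disjoint_closedHull_of_lt_hullHitTime (by rw [hT]; exact WithTop.coe_lt_coe.2 huT)
  exact Set.disjoint_left.1 halive ⟨hzK.1, by rw [← hu]⟩ hzB

/-- **`‖g_t z − W_t‖ ≤ S + 4√(T − t)`** for a point `z ∈ ℍ` swallowed at `T > t`, where `S` bounds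
`|W (t + s) − W t|` for `s ≤ T − t` (Lawler's Lemma 4.13 for the chain restarted at `t`; flow cocycle
`coe_add_lt_swallowingTime`). [cite: Lawler2005, Lemma 4.13] -/
theorem norm_map_sub_driving_le_of_swallowed_at (hW : Continuous W) {t T : ℝ≥0} (htT : t ≤ T)
    {S : ℝ} (hS : ∀ s : ℝ≥0, s ≤ T - t → |W (t + s) - W t| ≤ S) {z : ℂ} (hzH : 0 < z.im)
    (hzT : swallowingTime W z = T) (hzt : (t : WithTop ℝ≥0) < swallowingTime W z) :
    ‖map W t z - W t‖ ≤ S + 4 * Real.sqrt ((T - t : ℝ≥0) : ℝ) := by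
  have hzdom : z ∈ domain W t := (mem_domain_iff W t z).2 ⟨hzH, hzt⟩
  set U : ℝ≥0 → ℝ := fun v ↦ W (t + v) with hU
  have hUc : Continuous U := hW.comp (continuous_const.add continuous_id)
  have hw : map W t z ∈ upperHalfPlaneSet := mapsTo_map hW t hzdom
  have hw0 : map W t z ≠ U 0 := by
    intro h
    have : (map W t z).im = 0 := by rw [h, hU]; simp
    exact (show (0 : ℝ) < (map W t z).im from hw).ne' this
  have hwu : swallowingTime U (map W t z) ≤ ((T - t : ℝ≥0) : WithTop ℝ≥0) := by
    by_contra h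
    push Not at h
    have := coe_add_lt_swallowingTime hW hzdom h
    rw [hzT, add_tsub_cancel_of_le htT] at this
    exact lt_irrefl _ this
  have hS' : ∀ s : ℝ≥0, s ≤ T - t → |U s - U 0| ≤ S := fun s hs ↦ by
    simpa only [hU, add_zero] using hS s hs
  have := norm_sub_driving_le_of_swallowingTime_le hUc hS' hw0 hwu
  simpa only [hU, add_zero] using this

/-! ### The quotient-hull estimate -/

/-- **The shifts of two nested `*`-hulls differ by at most `1160 r`** when the difference set (in `ℍ`)
lies in `B̄(0, r)` and the smaller hull stays `ρ`-away from `0` with `2 r < ρ`: shift additivity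
`L_A = L_{A'} + L_Q` and `Q = cl Φ_{A'}((A ∖ A') ∩ ℍ) ⊆ B̄(0, 2r)` (`E_{A'}` is `2`-Lipschitz on
`B(0, ρ/2)`, `E_{A'}(0) = 0`), `‖L_Q‖ ≤ 580 · 2r`. [folklore] -/
theorem abs_starShift_re_sub_le_of_sdiff_subset {A A' : Set ℂ} (hA : IsStarHull A) (hA' : IsStarHull A')
    (hsub : A' ⊆ A) {ρ r : ℝ} (hr : 0 < r) (hrρ : 2 * r < ρ) (hρ : Disjoint (ball (0 : ℂ) ρ) A')
    (hdiff : ∀ w ∈ A \ A', 0 < w.im → ‖w‖ ≤ r) :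
    |(starShift A).re - (starShift A').re| ≤ 1160 * r := by
  set Φ := starRMap A' hA' with hΦ
  set Q := quotientHull A A' Φ with hQdef
  have hQ : IsStarHull Q := isStarHull_quotientHull_starRMap hA hA' hsub
  have hadd : starShift A = starShift A' + starShift Q := starShift_eq_add_starShift_quotientHull hA hA' hsub
  -- `Q ⊆ B̄(0, 2r)`
  have hlip : LipschitzOnWith 2 (hullExt Φ) (ball ((0 : ℝ) : ℂ) (ρ / 2)) :=
    lipschitzOnWith_hullExt hA'.1 (isRestrictionMap_starRMap hA') (by exact_mod_cast hρ)
  have h0ball : ((0 : ℝ) : ℂ) ∈ ball ((0 : ℝ) : ℂ) (ρ / 2) := mem_ball_self (by linarith)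
  have hQsub : Q ⊆ closedBall (0 : ℂ) (2 * r) := by
    have himg : Φ '' ((A \ A') ∩ upperHalfPlaneSet) ⊆ closedBall (0 : ℂ) (2 * r) := by
      rintro _ ⟨w, ⟨hwd, hwH⟩, rfl⟩
      have hwr : ‖w‖ ≤ r := hdiff w hwd hwH
      have hwA' : w ∈ upperHalfPlaneSet \ A' := ⟨hwH, hwd.2⟩
      have hwball : w ∈ ball ((0 : ℝ) : ℂ) (ρ / 2) := by
        rw [mem_ball, Complex.ofReal_zero, dist_zero_right]; linarith
      have h1 := hlip.dist_le_mul w hwball ((0 : ℝ) : ℂ) h0ball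
      rw [hullExt_of_mem_diff hwA', Complex.ofReal_zero, hullExt_zero hA' (isRestrictionMap_starRMap hA'),
        dist_zero_right, dist_zero_right] at h1
      rw [mem_closedBall, dist_zero_right]
      calc ‖(Φ w : ℂ)‖ ≤ 2 * ‖w‖ := by exact_mod_cast h1
        _ ≤ 2 * r := by linarith
    rw [hQdef, quotientHull]
    exact closure_minimal himg isClosed_closedBall
  have hQH : Q ∩ upperHalfPlaneSet ⊆ closedBall ((0 : ℝ) : ℂ) (2 * r) := by
    rw [Complex.ofReal_zero]; exact fun w hw ↦ hQsub hw.1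
  have hLQ : ‖starShift Q‖ ≤ 580 * (2 * r) := norm_starShift_le hQ (by linarith) hQH
  rw [hadd, Complex.add_re, add_sub_cancel_left]
  calc |(starShift Q).re| ≤ ‖starShift Q‖ := Complex.abs_re_le_norm _
    _ ≤ 580 * (2 * r) := hLQ
    _ = 1160 * r := by ring

/-! ### The theorem -/

/-- **(W) The shift `L_{B_t}` is continuous across the first contact of the closed hulls with `B`,
when the part still alive at the contact time is a clopen piece.** See the module docstring.
[cite: Lawler2005, §6.3 (continuity of U*_t); LawlerSchrammWerner2003Restriction, §5] -/
theorem tendsto_starShift_slidHull_hullHitTime (hW : Continuous W) (_hW0 : W 0 = 0) {B : Set ℂ}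
    (hB : IsStarHull B) (_hne : B.Nonempty) {T : ℝ≥0} (hT : hullHitTime W B = T)
    (hcl : IsClosed (B \ closedHull W T)) :
    Tendsto (fun t : ℝ≥0 ↦ (starShift (slidHull W B t)).re) (𝓝[<] T)
      (𝓝 ((starShift (slidHull W (B \ closedHull W T) T)).re)) := by
  set B' := B \ closedHull W T with hB'def
  have hcl' : IsClosed (B \ B') := by
    have : B \ B' = B ∩ closedHull W T := by
      rw [hB'def, Set.sdiff_sdiff_right, Set.sdiff_self, Set.empty_union]
    rw [this]; exact hB.1.isClosed.inter (isClosed_closedHull hW T)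
  have hB'sub : B' ⊆ B := sdiff_subset
  have hdisjT : Disjoint (closedHull W T) B' := Set.disjoint_left.2 fun z hz hzB' ↦ hzB'.2 hz
  have hBH : B ⊆ {z : ℂ | 0 ≤ z.im} := by
    rw [← hB.1.2.1, ← Complex.closure_setOf_lt_im 0]; exact closure_mono inter_subset_right
  -- alive before `T`; contacted points are swallowed at `T` exactly
  have halive : ∀ t : ℝ≥0, t < T → Disjoint (closedHull W t) B := fun t ht ↦
    disjoint_closedHull_of_lt_hullHitTime (by rw [hT]; exact WithTop.coe_lt_coe.2 ht)
  have hswT : ∀ z ∈ B, z ∉ B' → swallowingTime W z = T := fun z hzB hzB' ↦ by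
    have hzK : z ∈ closedHull W T := by
      by_contra h; exact hzB' ⟨hzB, h⟩
    exact swallowingTime_eq_of_mem_inter_closedHull hT hzB hzK
  have hlt : ∀ z ∈ B, ∀ t : ℝ≥0, t < T → (t : WithTop ℝ≥0) < swallowingTime W z := fun z hzB t ht ↦ by
    by_contra h
    push Not at h
    exact Set.disjoint_left.1 (halive t ht) ⟨hBH hzB, h⟩ hzB
  -- the difference `B_t ∖ B'_t` in `ℍ` consists of images of contacted points of `B ∩ ℍ`
  have hdiff : ∀ t : ℝ≥0, t < T → ∀ {S : ℝ}, (∀ s : ℝ≥0, s ≤ T - t → |W (t + s) - W t| ≤ S) →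
      ∀ w ∈ slidHull W B t \ slidHull W B' t, 0 < w.im →
        ‖w‖ ≤ S + 4 * Real.sqrt ((T - t : ℝ≥0) : ℝ) := by
    intro t ht S hS w hw hwim
    obtain ⟨⟨z, hzB, rfl⟩, hw'⟩ := hw
    have hzB' : z ∉ B' := fun h ↦ hw' ⟨z, h, rfl⟩
    have hzt := hlt z hzB t ht
    have hzH : 0 < z.im := by
      rcases (show (0 : ℝ) ≤ z.im from hBH hzB).lt_or_eq with h | h
      · exact h
      · exfalso
        have hzre : z = ((z.re : ℝ) : ℂ) := Complex.ext (by simp) (by simp [← h])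
        have him0 : (map W t z - W t).im = 0 := by
          rw [Complex.sub_im, Complex.ofReal_im, sub_zero, hzre]
          exact map_ofReal_im hW (by rw [← hzre]; exact hzt)
        exact hwim.ne' him0
    exact norm_map_sub_driving_le_of_swallowed_at hW ht.le hS hzH (hswT z hzB hzB') hzt
  -- uniform continuity of `W` on `[0, T + 1]`
  have hUC : ∀ {ε₁ : ℝ}, 0 < ε₁ → ∃ η : ℝ, 0 < η ∧ η ≤ 1 ∧ ∀ t : ℝ≥0, t < T → (T : ℝ) - t < η →
      ∀ s : ℝ≥0, s ≤ T - t → |W (t + s) - W t| ≤ ε₁ := by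
    intro ε₁ hε₁
    obtain ⟨η, hη, hmod⟩ := exists_forall_abs_sub_driving_le hW ((T : ℝ) + 1) hε₁
    refine ⟨min η 1, lt_min hη one_pos, min_le_right _ _, fun t ht htT s hs ↦ ?_⟩
    have hs' : (s : ℝ) ≤ (T : ℝ) - t := by
      have := NNReal.coe_le_coe.2 hs; rwa [NNReal.coe_sub ht.le] at this
    have h1 := hmod ((t : ℝ) + s) ⟨by positivity, by linarith⟩ t ⟨t.coe_nonneg, by
      have := NNReal.coe_le_coe.2 ht.le; linarith⟩ (by
      rw [show (t : ℝ) + s - t = s by ring, abs_of_nonneg s.coe_nonneg]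
      linarith [min_le_left η 1])
    have hts : ((t : ℝ) + s).toNNReal = t + s := by
      rw [show ((t : ℝ) + s) = ((t + s : ℝ≥0) : ℝ) by push_cast; ring, Real.toNNReal_coe]
    rwa [hts, Real.toNNReal_coe] at h1
  rw [Metric.tendsto_nhdsWithin_nhds]
  intro ε hε
  by_cases hB'ne : B'.Nonempty
  · -- the alive piece is a `*`-hull, alive at `T`
    have hB' : IsStarHull B' := hB.isStarHull_piece hB'sub hcl hcl'
    have hTlt : (T : WithTop ℝ≥0) < hullHitTime W B' := lt_hullHitTime_of_disjoint hW hB' hB'ne hdisjT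
    have haliveSet : Iic T ⊆ {t : ℝ≥0 | (t : WithTop ℝ≥0) < hullHitTime W B'} := fun t ht ↦
      lt_of_le_of_lt (WithTop.coe_le_coe.2 ht) hTlt
    -- a ball around `0` free of `B'_t` for `t ≤ T` near `T`
    set d₀ : ℝ := infDist (0 : ℂ) (slidHull W B' T) with hd₀
    have hBT : IsStarHull (slidHull W B' T) := isStarHull_slidHull_of_disjoint hW hB' hdisjT
    have hd₀pos : 0 < d₀ := by
      rw [hd₀, ← hBT.1.isClosed.notMem_iff_infDist_pos (hB'ne.image _)]
      exact hBT.2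
    have hcontDist : ContinuousWithinAt (fun t : ℝ≥0 ↦ infDist (0 : ℂ) (slidHull W B' t)) (Iic T) T :=
      ((continuousOn_infDist_slidHull hW hB' hB'ne) T (haliveSet self_mem_Iic)).mono haliveSet
    obtain ⟨η₀, hη₀, hdist⟩ := Metric.continuousWithinAt_iff.1 hcontDist (d₀ / 2) (by positivity)
    set ρ : ℝ := d₀ / 2 with hρ
    have hρpos : 0 < ρ := by positivity
    have hball : ∀ t : ℝ≥0, t ≤ T → dist t T < η₀ → Disjoint (ball (0 : ℂ) ρ) (slidHull W B' t) := by
      intro t htT htd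
      have h1 : dist (infDist (0 : ℂ) (slidHull W B' t)) d₀ < d₀ / 2 := hdist htT htd
      rw [Real.dist_eq, abs_lt] at h1
      refine Set.disjoint_left.2 fun y hy hyB ↦ ?_
      have h2 : infDist (0 : ℂ) (slidHull W B' t) ≤ dist 0 y := infDist_le_dist_of_mem hyB
      rw [mem_ball, dist_comm] at hy
      linarith
    -- continuity of `t ↦ L_{B'_t}` at `T` from the left
    have hcontL : ContinuousWithinAt (fun t : ℝ≥0 ↦ (starShift (slidHull W B' t)).re) (Iic T) T := by
      have h1 : ContinuousWithinAt (fun v : ℝ≥0 ↦ imageDriver W B' v) (Iic T) T :=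
        (continuousWithinAt_imageDriver hW hB' hB'ne hdisjT).mono fun t ht ↦
          disjoint_closedHull_of_lt_hullHitTime (haliveSet ht)
      have h2 : ContinuousWithinAt (fun v : ℝ≥0 ↦ W v + (starShift B').re - imageDriver W B' v) (Iic T) T :=
        ((hW.continuousWithinAt).add continuousWithinAt_const).sub h1
      refine h2.congr (fun t _ ↦ ?_) ?_ <;> simp only [imageDriver] <;> ring
    obtain ⟨η₃, hη₃, hL⟩ := Metric.continuousWithinAt_iff.1 hcontL (ε / 2) (by positivity)
    -- the modulus of continuity scale
    set ε₁ : ℝ := min (ρ / 8) (ε / (8 * 1160)) with hε₁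
    have hε₁pos : 0 < ε₁ := lt_min (by positivity) (by positivity)
    obtain ⟨η₁, hη₁, -, hmod⟩ := hUC hε₁pos
    set η₂ : ℝ := (ε₁ / 4) ^ 2 with hη₂
    have hη₂pos : 0 < η₂ := by positivity
    refine ⟨min (min η₀ η₃) (min η₁ η₂), lt_min (lt_min hη₀ hη₃) (lt_min hη₁ hη₂pos), fun t ht htd ↦ ?_⟩
    have htT : t < T := ht
    have hdistT : dist t T = (T : ℝ) - t := by
      rw [NNReal.dist_eq, abs_sub_comm, abs_of_nonneg (by have := NNReal.coe_le_coe.2 htT.le; linarith)]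
    have hd0 : dist t T < η₀ := lt_of_lt_of_le htd ((min_le_left _ _).trans (min_le_left _ _))
    have hd3 : dist t T < η₃ := lt_of_lt_of_le htd ((min_le_left _ _).trans (min_le_right _ _))
    have hd1 : (T : ℝ) - t < η₁ := by rw [← hdistT]; exact lt_of_lt_of_le htd ((min_le_right _ _).trans (min_le_left _ _))
    have hd2 : (T : ℝ) - t < η₂ := by rw [← hdistT]; exact lt_of_lt_of_le htd ((min_le_right _ _).trans (min_le_right _ _))
    -- the radius `r = ε₁ + 4√(T - t) ≤ 2 ε₁`
    set r : ℝ := ε₁ + 4 * Real.sqrt ((T - t : ℝ≥0) : ℝ) with hrdef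
    have hsqrt : Real.sqrt ((T - t : ℝ≥0) : ℝ) ≤ ε₁ / 4 := by
      rw [NNReal.coe_sub htT.le]
      calc Real.sqrt ((T : ℝ) - t) ≤ Real.sqrt η₂ := Real.sqrt_le_sqrt hd2.le
        _ = ε₁ / 4 := by rw [hη₂, Real.sqrt_sq (by positivity)]
    have hrpos : 0 < r := by rw [hrdef]; positivity
    have hr2 : r ≤ 2 * ε₁ := by rw [hrdef]; linarith
    have hrρ : 2 * r < ρ := by
      have : ε₁ ≤ ρ / 8 := min_le_left _ _
      linarith
    -- the two-hull estimate at time `t`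
    have hBt : IsStarHull (slidHull W B t) := isStarHull_slidHull_of_disjoint hW hB (halive t htT)
    have hB't : IsStarHull (slidHull W B' t) :=
      isStarHull_slidHull_of_disjoint hW hB' ((halive t htT).mono_right hB'sub)
    have hsubt : slidHull W B' t ⊆ slidHull W B t := image_mono hB'sub
    have hest := abs_starShift_re_sub_le_of_sdiff_subset hBt hB't hsubt hrpos hrρ
      (hball t htT.le hd0) (fun w hw hwim ↦ hdiff t htT (hmod t htT hd1) w hw hwim)
    have hL' : dist ((starShift (slidHull W B' t)).re) ((starShift (slidHull W B' T)).re) < ε / 2 :=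
      hL htT.le hd3
    rw [Real.dist_eq] at hL' ⊢
    have h1160 : 1160 * r ≤ ε / 4 := by
      have : ε₁ ≤ ε / (8 * 1160) := min_le_right _ _
      calc 1160 * r ≤ 1160 * (2 * ε₁) := by nlinarith
        _ ≤ 1160 * (2 * (ε / (8 * 1160))) := by nlinarith
        _ = ε / 4 := by ring
    calc |(starShift (slidHull W B t)).re - (starShift (slidHull W B' T)).re|
        ≤ |(starShift (slidHull W B t)).re - (starShift (slidHull W B' t)).re| +
          |(starShift (slidHull W B' t)).re - (starShift (slidHull W B' T)).re| := abs_sub_le _ _ _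
      _ < ε / 4 + ε / 2 := add_lt_add_of_le_of_lt (hest.trans h1160) hL'
      _ ≤ ε := by linarith
  · -- everything is contacted: `B' = ∅`, the slid hull shrinks into small balls, `L_∅ = 0`
    have hB'e : B' = ∅ := Set.not_nonempty_iff_eq_empty.1 hB'ne
    have htarget : (starShift (slidHull W B' T)).re = 0 := by
      rw [hB'e, slidHull_empty, starShift_empty, Complex.zero_re]
    set ε₁ : ℝ := ε / (4 * 580) with hε₁
    have hε₁pos : 0 < ε₁ := by positivity
    obtain ⟨η₁, hη₁, -, hmod⟩ := hUC hε₁pos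
    set η₂ : ℝ := (ε₁ / 4) ^ 2 with hη₂
    have hη₂pos : 0 < η₂ := by positivity
    refine ⟨min η₁ η₂, lt_min hη₁ hη₂pos, fun t ht htd ↦ ?_⟩
    have htT : t < T := ht
    have hdistT : dist t T = (T : ℝ) - t := by
      rw [NNReal.dist_eq, abs_sub_comm, abs_of_nonneg (by have := NNReal.coe_le_coe.2 htT.le; linarith)]
    have hd1 : (T : ℝ) - t < η₁ := by rw [← hdistT]; exact lt_of_lt_of_le htd (min_le_left _ _)
    have hd2 : (T : ℝ) - t < η₂ := by rw [← hdistT]; exact lt_of_lt_of_le htd (min_le_right _ _)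
    set r : ℝ := ε₁ + 4 * Real.sqrt ((T - t : ℝ≥0) : ℝ) with hrdef
    have hsqrt : Real.sqrt ((T - t : ℝ≥0) : ℝ) ≤ ε₁ / 4 := by
      rw [NNReal.coe_sub htT.le]
      calc Real.sqrt ((T : ℝ) - t) ≤ Real.sqrt η₂ := Real.sqrt_le_sqrt hd2.le
        _ = ε₁ / 4 := by rw [hη₂, Real.sqrt_sq (by positivity)]
    have hrpos : 0 < r := by rw [hrdef]; positivity
    have hr2 : r ≤ 2 * ε₁ := by rw [hrdef]; linarith
    have hBt : IsStarHull (slidHull W B t) := isStarHull_slidHull_of_disjoint hW hB (halive t htT)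
    have hsubball : slidHull W B t ∩ upperHalfPlaneSet ⊆ closedBall ((0 : ℝ) : ℂ) r := by
      intro w hw
      have hw' : w ∈ slidHull W B t \ slidHull W B' t := by
        refine ⟨hw.1, ?_⟩
        rw [hB'e, slidHull_empty]; exact Set.notMem_empty w
      have := hdiff t htT (hmod t htT hd1) w hw' hw.2
      rw [mem_closedBall, Complex.ofReal_zero, dist_zero_right]; exact this
    have hLt : ‖starShift (slidHull W B t)‖ ≤ 580 * r := norm_starShift_le hBt hrpos hsubball
    rw [Real.dist_eq, htarget, sub_zero]
    calc |(starShift (slidHull W B t)).re| ≤ ‖starShift (slidHull W B t)‖ := Complex.abs_re_le_norm _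
      _ ≤ 580 * r := hLt
      _ ≤ 580 * (2 * ε₁) := by nlinarith
      _ = ε / 2 := by rw [hε₁]; ring
      _ < ε := by linarith

end Loewner

end Literature.Probability.RandomPlanarGeometry

end
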